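import Mathlib
import Literature.Analysis.FluidPDE.NSBoundedMildAnalytic
import Literature.Analysis.FluidPDE.OseenMildUniqueness
import Literature.Analysis.FluidPDE.SelfSimilar
import Summits.NavierStokesRegularity.NavierStokesRegularity.Theorems.LocalSineTubeDoorProfileAlignedWindowRigidityAncient

/-!
# Support lemma (prices R4 / P5 of `entire_slices`, P1 of `string_shells`): a Type-I, continuous,
Oseen-mild ancient field is jointly real-analytic in space–time on `(-∞,0) × ℝ³`.

Filed by ns-idea-8 g0 (planner) as the ONE shared analyticity debt of both lines on crux
stmt-NavierStokesRegularity-19708 (`PoloidalWindowRigidity`).  The critic (idea-crit-7, verdicts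
03:16:10Z R4 and 04:03:24Z P1) priced «(M)+Type-I ⇒ v real-analytic» as a fact NOT in the tree; it IS
in the tree in the strongest (joint space–time) form, as the PROVED local fact
`Literature.Analysis.FluidPDE.lemarieRieusset2016_local_analyticity_holds` (Lemarié-Rieusset 2016,
Thm. 9.12: the Oseen scheme from an `L^∞` datum is real-analytic on `(s, s + ε ν / M²) × ℝ³`) together with
`Literature.Analysis.FluidPDE.oseenMild_essBounded_unique` (bounded solutions of
`w(t) = e^{ν(t-s)Δ}a - B^ν_s(w,w)(t)` are unique a.e.).

**v2 (2026-08-28T05:0xZ): BOTH LEMMAS ARE NOW PROVED, NO `sorry`.**  The glue was already done in the tree: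
`…Theorems.LocalSineTubeDoorProfileAlignedWindowRigidityAncient.analyticOnNhd_uncurry` (joint real-analyticity of an
Oseen-mild ancient field bounded on every `(-∞,-δ)`) with `…bdd_of_hasTypeITimeDecay` (Type-I ⇒ those bounds) closes
`typeI_mild_analyticOnNhd` in one term.  The plan below is kept only as documentation of what that tree theorem does.

(ORIGINAL) PROOF PLAN.  Fix `t₀ < 0`, `x₀`.  Put `t₁ := t₀ / 2`, `M := C / √(-t₁) + 1`, so `‖v τ y‖ ≤ M` for all
`τ ≤ t₁` (Type-I: `‖v τ y‖ ≤ C/√(-τ) ≤ C/√(-t₁)`).  Let `ε, C'` be the constants of the local fact and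
`δ := min (ε / (2 M²)) (-t₀ / 4)`, `s := t₀ - δ`.  The local fact at `(ν, s, M, a := v s)` (`v s` is
continuous hence `AEStronglyMeasurable`, and `eLpNorm (v s) ∞ ≤ M`) gives `vl` analytic on
`W := Ioo s (s + ε/M²) ×ˢ univ` solving the Oseen identity from `s` pointwise with `‖vl‖ ≤ C' M`.  On
`I := Ioo s (min (s + ε/M²) t₁) ∋ t₀` both `v` (hypothesis `hmild`, pointwise ⇒ a.e.) and `vl` solve the
same identity with `U t x := heatExtension (v s) (1 * (t - s)) x` and are bounded by `M' := max M (C' M)`;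
measurability of `uncurry v` / `uncurry vl` on `I ×ˢ univ` from continuity / analyticity; hence
`oseenMild_essBounded_unique` ⇒ `v t =ᵐ vl t` for `t ∈ I`; both slices are continuous in `x`
(`hcont`, resp. analyticity) ⇒ `v t = vl t` on `I` (a.e.-equal continuous functions agree:
`Measure.eqOn_of_ae_eq` on an open-positive measure / `Continuous.ae_eq_iff_eq`).  So `uncurry v = uncurry vl`
on the open set `I ×ˢ univ ∋ (t₀, x₀)` and `AnalyticOnNhd.congr` (Mathlib) transfers analyticity.
Mind `ν = 1`: the crux's identity is `heatExtension (v s) (t - s)` = `heatExtension (v s) (1 * (t - s))`.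

No summit is proved by this lemma; it discharges a shared hypothesis of two crux lines. -/

namespace Summit.NavierStokesRegularity.NavierStokesRegularity.Cruxes.PoloidalWindowRigidity.Support

open Set Function MeasureTheory Literature.Analysis.FluidPDE Literature.Analysis.UnboundedOperators

/-- support (PROVED, v2): Type-I + continuity + Oseen-mild from every past time ⇒ joint real-analyticity
on `(-∞, 0) × ℝ³`.  One term over the tree theorem `analyticOnNhd_uncurry`; the originally planned ingredients were `lemarieRieusset2016_local_analyticity_holds`,
`oseenMild_essBounded_unique`, `AnalyticOnNhd.congr`.  See the module docstring for the proof plan. -/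
theorem typeI_mild_analyticOnNhd (C : ℝ)
    (v : ℝ → EuclideanSpace ℝ (Fin 3) → EuclideanSpace ℝ (Fin 3))
    (hT : HasTypeITimeDecay C v)
    (hcont : ContinuousOn (uncurry v) (Iio (0 : ℝ) ×ˢ univ))
    (hmild : ∀ s t : ℝ, s < t → t < 0 → ∀ x,
      v t x = heatExtension (v s) (t - s) x - oseenDuhamel 1 s v v t x) :
    AnalyticOnNhd ℝ (uncurry v) (Iio (0 : ℝ) ×ˢ (univ : Set (EuclideanSpace ℝ (Fin 3)))) :=
  -- v2 (2026-08-28): CLOSED by the tree theorem `…LocalSineTubeDoorProfileAlignedWindowRigidityAncient.analyticOnNhd_uncurry`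
  -- (joint real-analyticity of bounded-on-`(-∞,-δ)` Oseen-mild ancient fields) + `bdd_of_hasTypeITimeDecay` (Type-I ⇒ the bound).
  Summit.NavierStokesRegularity.NavierStokesRegularity.Theorems.LocalSineTubeDoorProfileAlignedWindowRigidityAncient.analyticOnNhd_uncurry
    hcont
    (Summit.NavierStokesRegularity.NavierStokesRegularity.Theorems.LocalSineTubeDoorProfileAlignedWindowRigidityAncient.bdd_of_hasTypeITimeDecay
      hT)
    hmild

/-- Corollary used by the lines: every negative-time slice is real-analytic in space. -/
theorem typeI_mild_slice_analytic (C : ℝ)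
    (v : ℝ → EuclideanSpace ℝ (Fin 3) → EuclideanSpace ℝ (Fin 3))
    (hT : HasTypeITimeDecay C v)
    (hcont : ContinuousOn (uncurry v) (Iio (0 : ℝ) ×ˢ univ))
    (hmild : ∀ s t : ℝ, s < t → t < 0 → ∀ x,
      v t x = heatExtension (v s) (t - s) x - oseenDuhamel 1 s v v t x) :
    ∀ s < 0, AnalyticOnNhd ℝ (v s) univ := by
  intro s hs x _
  have h := typeI_mild_analyticOnNhd C v hT hcont hmild (s, x) ⟨hs, mem_univ _⟩
  -- restrict a jointly analytic function to the slice `t = s`: compose with the analytic map `x ↦ (s, x)`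
  have hι : AnalyticAt ℝ (fun y : EuclideanSpace ℝ (Fin 3) => ((s, y) : ℝ × EuclideanSpace ℝ (Fin 3))) x :=
    (analyticAt_const.prod analyticAt_id)
  exact (h.comp hι)

end Summit.NavierStokesRegularity.NavierStokesRegularity.Cruxes.PoloidalWindowRigidity.Support
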